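import Summits.BirchSwinnertonDyer.BirchSwinnertonDyer.Theorems.ThetaPartnerAtTwoSignedMainConjectureCMTwoRankZeroUnitZonePub
import HarnessLib

/-!
# Route `ThetaPartnerAtTwo` (TP2), crux K2r0 `SignedMainConjectureCMTwoRankZero` (stmt-BirchSwinnertonDyer-20312), line
# `rankzero` v12: the crux BODY, class-wide, from PUB + the two global research binders — the composition of the registered
# skeleton as a route-independent tree theorem (phase-T twin K2r0P = `intro`s + this theorem)

HONEST FRAMING (cell `pub/bsd-wall`, W-ALL row 1, lead prover `bsd-wall-tp2-p2` g5). The crux is NOT proved: the two displayed binders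
(LD±2^k) (one-sided Eisenstein half of Kobayashi's `+` main conjecture at `2` in `Λ ⊗ ℚ₂`, off the unit zone) and (μ♭) (a unit
coefficient of `L♭`, off the unit zone) are RESEARCH statements at `p = 2` (Pollack–Rubin 2004 is `p > 2`; analytic `μ = 0` at `2` is open
class-wide). What is proved: GRANTED those two class-wide binders and the published inputs BY NAME (Burungale–Flach, modularity ×2, GZK,
period unit at `2`, Greenberg ×5), the BODY of the crux holds for every CM `A` of analytic rank `0`, good supersingular at `2`, `a₂ = 0`
— by cases on the zone through p593505 (`…_at_unitZone_of_pub`, `…_at_of_pub_of_lowerUpToTwoPower_of_flat`); the `±` local theory at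
`2` is the LANDED `SignedEC.PlusLayer.plusHondaSystemTwo_adicCompletion` (p592468 ← p591589). This file imports no `Theses` module; the
registered skeleton `Cruxes/SignedMainConjectureCMTwoRankZero/Lines/rankzero.lean` (v13) concludes the route decl BY NAME from it in one
line, and so will the T10v2 twin K2r0P (PUB antecedents `intro`duced). BSD is not proved by any of this.

References: [PollackRubin2004] Thm. 7.3 (p > 2); [Kobayashi2003] Thm. 1.2, §8.4, Conjecture (p. 2); [BurungaleFlach2024] Thm. 1.1;
[GreenbergLNM1716] Prop. 4.12, Prop. 4.13, pp. 108, 140; [AbbesUllmo1996] Thm. A.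
-/

set_option autoImplicit false
-- the Theorems namespace of this sub repeats the summit name by design (D-0017 nested layout)
set_option linter.dupNamespace false

noncomputable section

open scoped Classical NumberField MatrixGroups ModularForm

open NumberField IsDedekindDomain CongruenceSubgroup

namespace Summit.BirchSwinnertonDyer.BirchSwinnertonDyer.Theorems

open Literature.NumberTheory.EllipticCurves Literature.NumberTheory.GaloisRepresentations
  WeierstrassCurve ZpExtension Literature.NumberTheory.EllipticCurves.Kobayashi2003
  Literature.NumberTheory.EllipticCurves.IwasawaDual Literature.NumberTheory.EllipticCurves.GreenbergVatsal2000
  Literature.NumberTheory.EllipticCurves.ModularForms Literature.NumberTheory.EllipticCurves.Rank1Residual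
  Literature.NumberTheory.EllipticCurves.Rank1Residual.Typed
  Summit.BirchSwinnertonDyer.Rank1Residual Summit.BirchSwinnertonDyer.Rank1Residual.Supersingular

/-- **The BODY of K2r0, class-wide, from PUB (ten named facts) + (LD±2^k) + (μ♭).** For every CM `A/ℚ` (globally minimal) of
analytic rank `0`, good supersingular at `2`, `a₂ = 0`: `X⁺(A/ℚ_∞)` torsion with `μ⁺ = 0` at every cyclotomic top-generator pair, and
`KobayashiMainConjecture A 2 1` — by cases on `2 ∣ #Ш(A)·∏c_ℓ(A)` (off-zone: the two research binders; unit zone: print only).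
[cite: PollackRubin2004, Thm. 7.3 (p > 2)] [cite: Kobayashi2003, Thm. 1.2, §8.4, Conjecture (p. 2)] [cite: BurungaleFlach2024, Thm. 1.1] -/
theorem signedMainConjectureCMTwoRankZero_body_of_pub_of_stubs
    (hBF : bsdTriple_of_hasCM_of_L_one_ne_zero)
    (hmod : nonempty_modularParametrizationData) (hLrat : hasEntireLFunction_rat)
    (hGZK : rank_eq_analyticRank_of_analyticRank_le_one)
    (h2 : Literature.NumberTheory.EllipticCurves.realPeriodRat_eq_unit_mul_plusPeriod_two)
    (hC : Greenberg1999.casselsSurjectivity_H1Sigma ℚ)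
    (h412 : Greenberg1999.prop412_noFiniteSubmodule_H1Sigma_of_rank_one)
    (hcork : Greenberg1999.h1Sigma_zpCorank_le_degree ℚ)
    (hP108 : Greenberg1999.localQuotient_restriction_surjective ℚ)
    (hWL : Greenberg1999.h1SigmaInfty_rank_eq_one)
    (hLD : ∀ (A : WeierstrassCurve ℚ) [A.IsElliptic] [A.IsGloballyMinimal],
      A.HasCM → A.analyticRank = 0 → GoodSS A 2 → A.frobeniusTrace 2 = 0 →
      2 ∣ A.shaOrder * A.tamagawaProduct →
      ∀ (κ : ZpExtension ℚ 2) (γ : Field.absoluteGaloisGroup ℚ),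
        κ.IsCyclotomic → κ.IsTopGenerator γ → IsCyclotomicVariable 2 γ →
      ∀ [NeZero (A.conductorNorm ℤ)] (f : CuspForm (Gamma0 (A.conductorNorm ℤ)) 2),
        IsNewformOf A f → ∀ (ϖ : ℚ), (ϖ : ℝ) * A.realPeriodRat = plusPeriod f →
      ∀ (Lplus Lminus : IwasawaAlgebra 2), IsPollackPair f 2 Lplus Lminus →
      ∀ (D : SignedSelmerDualData A κ γ 1),
        ∃ (g h : IwasawaAlgebra 2) (m m' : ℕ), D.charIdeal = Ideal.span {g} ∧
          PowerSeries.C ((2 : ℚ_[2]) ^ m') * iwasawaToPowerSeries 2 g =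
            PowerSeries.C ((2 : ℚ_[2]) ^ m * (ϖ : ℚ_[2])) * iwasawaToPowerSeries 2 (kobayashiL 1 Lplus Lminus * h))
    (hμ : ∀ (A : WeierstrassCurve ℚ) [A.IsElliptic] [A.IsGloballyMinimal],
      A.HasCM → A.analyticRank = 0 → GoodSS A 2 → A.frobeniusTrace 2 = 0 →
      2 ∣ A.shaOrder * A.tamagawaProduct →
      ∀ [NeZero (A.conductorNorm ℤ)] (f : CuspForm (Gamma0 (A.conductorNorm ℤ)) 2),
      IsNewformOf A f → ∀ (Lplus Lminus : IwasawaAlgebra 2), IsPollackPair f 2 Lplus Lminus →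
        ∃ n : ℕ, IsUnit (PowerSeries.coeff n (kobayashiL 1 Lplus Lminus)))
    (A : WeierstrassCurve ℚ) [A.IsElliptic] [A.IsGloballyMinimal]
    (hcm : A.HasCM) (hr : A.analyticRank = 0) (hss : GoodSS A 2) (ha : A.frobeniusTrace 2 = 0) :
    (∀ (κ : ZpExtension ℚ 2) (γ : Field.absoluteGaloisGroup ℚ), κ.IsCyclotomic → κ.IsTopGenerator γ →
      ∀ D : SignedSelmerDualData A κ γ 1, Module.IsTorsion (IwasawaAlgebra 2) D.X ∧ D.mu = 0) ∧
    KobayashiMainConjecture A 2 1 := by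
  by_cases hz : 2 ∣ A.shaOrder * A.tamagawaProduct
  · exact signedMainConjectureCMTwoRankZero_at_of_pub_of_lowerUpToTwoPower_of_flat hBF hmod hLrat hGZK h2 hC h412 hcork hP108 hWL
      A hcm hr hss ha (hLD A hcm hr hss ha hz) (hμ A hcm hr hss ha hz)
  · exact signedMainConjectureCMTwoRankZero_at_unitZone_of_pub hBF hmod hLrat hGZK h2 hC h412 hcork hP108 hWL A hcm hr hss ha hz

/-- **The same with PUB bundled** as the registered stub `stub_publishedInputsCMTwo`'s conjunction (= T10v2's PUBCM ∧ PUBG).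
[cite: BurungaleFlach2024, Thm. 1.1] [cite: GreenbergLNM1716, Prop. 4.12, pp. 108, 140] -/
theorem signedMainConjectureCMTwoRankZero_body_of_pubConj_of_stubs
    (hPUB : (bsdTriple_of_hasCM_of_L_one_ne_zero ∧ nonempty_modularParametrizationData ∧
        hasEntireLFunction_rat ∧ rank_eq_analyticRank_of_analyticRank_le_one ∧
        Literature.NumberTheory.EllipticCurves.realPeriodRat_eq_unit_mul_plusPeriod_two) ∧
      (Greenberg1999.casselsSurjectivity_H1Sigma ℚ ∧ Greenberg1999.prop412_noFiniteSubmodule_H1Sigma_of_rank_one ∧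
        Greenberg1999.h1Sigma_zpCorank_le_degree ℚ ∧ Greenberg1999.localQuotient_restriction_surjective ℚ ∧
        Greenberg1999.h1SigmaInfty_rank_eq_one))
    (hLD : ∀ (A : WeierstrassCurve ℚ) [A.IsElliptic] [A.IsGloballyMinimal],
      A.HasCM → A.analyticRank = 0 → GoodSS A 2 → A.frobeniusTrace 2 = 0 →
      2 ∣ A.shaOrder * A.tamagawaProduct →
      ∀ (κ : ZpExtension ℚ 2) (γ : Field.absoluteGaloisGroup ℚ),
        κ.IsCyclotomic → κ.IsTopGenerator γ → IsCyclotomicVariable 2 γ →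
      ∀ [NeZero (A.conductorNorm ℤ)] (f : CuspForm (Gamma0 (A.conductorNorm ℤ)) 2),
        IsNewformOf A f → ∀ (ϖ : ℚ), (ϖ : ℝ) * A.realPeriodRat = plusPeriod f →
      ∀ (Lplus Lminus : IwasawaAlgebra 2), IsPollackPair f 2 Lplus Lminus →
      ∀ (D : SignedSelmerDualData A κ γ 1),
        ∃ (g h : IwasawaAlgebra 2) (m m' : ℕ), D.charIdeal = Ideal.span {g} ∧
          PowerSeries.C ((2 : ℚ_[2]) ^ m') * iwasawaToPowerSeries 2 g =
            PowerSeries.C ((2 : ℚ_[2]) ^ m * (ϖ : ℚ_[2])) * iwasawaToPowerSeries 2 (kobayashiL 1 Lplus Lminus * h))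
    (hμ : ∀ (A : WeierstrassCurve ℚ) [A.IsElliptic] [A.IsGloballyMinimal],
      A.HasCM → A.analyticRank = 0 → GoodSS A 2 → A.frobeniusTrace 2 = 0 →
      2 ∣ A.shaOrder * A.tamagawaProduct →
      ∀ [NeZero (A.conductorNorm ℤ)] (f : CuspForm (Gamma0 (A.conductorNorm ℤ)) 2),
      IsNewformOf A f → ∀ (Lplus Lminus : IwasawaAlgebra 2), IsPollackPair f 2 Lplus Lminus →
        ∃ n : ℕ, IsUnit (PowerSeries.coeff n (kobayashiL 1 Lplus Lminus)))
    (A : WeierstrassCurve ℚ) [A.IsElliptic] [A.IsGloballyMinimal]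
    (hcm : A.HasCM) (hr : A.analyticRank = 0) (hss : GoodSS A 2) (ha : A.frobeniusTrace 2 = 0) :
    (∀ (κ : ZpExtension ℚ 2) (γ : Field.absoluteGaloisGroup ℚ), κ.IsCyclotomic → κ.IsTopGenerator γ →
      ∀ D : SignedSelmerDualData A κ γ 1, Module.IsTorsion (IwasawaAlgebra 2) D.X ∧ D.mu = 0) ∧
    KobayashiMainConjecture A 2 1 := by
  obtain ⟨⟨hBF, hmod, hLrat, hGZK, h2⟩, hC, h412, hcork, hP108, hWL⟩ := hPUB
  exact signedMainConjectureCMTwoRankZero_body_of_pub_of_stubs hBF hmod hLrat hGZK h2 hC h412 hcork hP108 hWL hLD hμ A hcm hr hss ha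

end Summit.BirchSwinnertonDyer.BirchSwinnertonDyer.Theorems

end
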